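import Literature.Topology.FourManifolds.TrisectionSectorCollars
import Literature.Topology.FourManifolds.SPC4HandlesModelReduction
import HarnessLib

/-!
# The boundary manifold of a 1-handlebody: `π₁(b.carrier) ≅ π₁(V)` and path connectivity, in
# every dimension

Topic `Literature/Topology/FourManifolds`; the `π₁` bookkeeping between a boundary datum `b`
(`b.carrier ≅ ∂V`, a closed manifold with its own smooth structure) and a compact connected
`(n + 1)`-manifold with boundary `V` carrying a handle decomposition with one 0-handle and `k`
1-handles — the dimension-free form of §2 of `SPC4HandlesLemma2Direct.lean` (there `n + 1 = 4`),
needed in dimension `5` by the roadmap in `PresentationHandlebodyFiveProofs.lean` (an attaching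
circle representing a class of `π₁(V)` is fed to Whitney's theorem in the closed 4-manifold
`b.carrier`, through `ContinuousMap.homotopic_of_homotopic_comp_of_bijective`):

* `Literature.Topology.FourManifolds.BoundaryData.inclContinuousMap` — `b.incl` as a continuous map
  (the name `BoundaryData.inclC` is taken by `CobordismAttachmentHomology.lean`, dimensions `n + 2`);
  `Literature.Topology.FourManifolds.BoundaryData.carrierHomeomorphBoundary` — `b.carrier ≃ₜ ∂V`;
* `Literature.Topology.FourManifolds.BoundaryData.mapOfEq_inclContinuousMap_eq_inclHom_comp` —
  `(b.incl)_# = i_# ∘ (b.carrier ≅ ∂V)_#` on `π₁`;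
* `Literature.Topology.FourManifolds.HasHandleDecomposition.bijective_mapOfEq_inclContinuousMap` — **for a
  1-handlebody with one 0-handle of dimension `n + 1 ≥ 4`, `(b.incl)_# : π₁(b.carrier, z) →
  π₁(V, b.incl z)` is bijective** (`HasHandleDecomposition.bijective_inclHom_boundary`: the dual
  handles have dimension `≥ 3`);
* `Literature.Topology.FourManifolds.HasHandleDecomposition.pathConnectedSpace_carrier` — the
  boundary manifold of a 1-handlebody of dimension `n + 1 ≥ 3` is path connected
  (`HasHandleDecomposition.isPathConnected_boundary`, Kosinski VI (11.5)).

Everything here is proved; no named facts are introduced.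

## References

* A. A. Kosinski, *Differential Manifolds* (1993), VI (11.5) (handles of coindex `≥ 2` do not
  disconnect the boundary); VII §7. [Kosinski1993]
* A. Hatcher, *Algebraic Topology* (2002), §1.1 (functoriality), Prop. 1.26. [HatcherAT2002]
-/

open scoped Manifold ContDiff Topology
open Set Function

noncomputable section

namespace Literature.Topology.FourManifolds

open Literature.AlgebraicTopology.FundamentalGroup

universe u

variable {n : ℕ} {V : Type u} [TopologicalSpace V] [ChartedSpace (EuclideanHalfSpace (n + 1)) V]
  (b : BoundaryData (𝓡∂ (n + 1)) V (𝓡 n))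

/-- `b.incl` as a continuous map. [folklore] -/
abbrev BoundaryData.inclContinuousMap : C(b.carrier, V) := ⟨b.incl, b.continuous_incl⟩

/-- The carrier of a boundary datum is homeomorphic to the boundary `∂V ⊆ V` (as a subspace),
by `b.incl` (an embedding with image `∂V`). [folklore] -/
def BoundaryData.carrierHomeomorphBoundary : b.carrier ≃ₜ ((𝓡∂ (n + 1)).boundary V) :=
  b.isSmoothEmbedding.isEmbedding.toHomeomorph.trans (Homeomorph.setCongr b.range_incl)

/-- `BoundaryData.carrierHomeomorphBoundary` is `b.incl` with values in the subtype `∂V`.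
[folklore] -/
@[simp]
theorem BoundaryData.coe_carrierHomeomorphBoundary_apply (w : b.carrier) :
    (b.carrierHomeomorphBoundary w : V) = b.incl w := by
  simp [BoundaryData.carrierHomeomorphBoundary, Topology.IsEmbedding.toHomeomorph,
    Homeomorph.setCongr]

/-- **Factorisation of `(b.incl)_#` through the boundary subspace**:
`(b.incl)_# = i_# ∘ (b.carrier ≅ ∂V)_#`, `i : ∂V ↪ V` (functoriality, Hatcher (2002), §1.1).
[folklore] -/
theorem BoundaryData.mapOfEq_inclContinuousMap_eq_inclHom_comp (z : b.carrier)
    (a : FundamentalGroup b.carrier z) :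
    FundamentalGroup.mapOfEq b.inclContinuousMap (rfl : b.inclContinuousMap z = b.incl z) a =
      VanKampen.inclHom ((𝓡∂ (n + 1)).boundary V) (b.incl z) (b.incl_mem_boundary z)
        (Homeomorph.fundamentalGroupCongr b.carrierHomeomorphBoundary
          (Subtype.ext (b.coe_carrierHomeomorphBoundary_apply z)) a) := by
  rw [Homeomorph.fundamentalGroupCongr_apply, VanKampen.inclHom,
    ← FundamentalGroup.mapOfEq_comp_apply
      (b.carrierHomeomorphBoundary : C(b.carrier, (𝓡∂ (n + 1)).boundary V))
      (VanKampen.incl ((𝓡∂ (n + 1)).boundary V))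
      (Subtype.ext (b.coe_carrierHomeomorphBoundary_apply z)) rfl a]
  exact FundamentalGroup.mapOfEq_congr
    (ContinuousMap.ext fun w => (b.coe_carrierHomeomorphBoundary_apply w).symm) _ a

/-- **`π₁(b.carrier) ≅ π₁(V)` for a 1-handlebody with one 0-handle of dimension `≥ 4`**: if the
compact connected `V` (dimension `n + 1`, `3 ≤ n`) has a handle decomposition with one
0-handle, `k` 1-handles and no other handles, then `(b.incl)_# : π₁(b.carrier, z) →
π₁(V, b.incl z)` is bijective for every boundary datum `b` and every `z`
(`HasHandleDecomposition.bijective_inclHom_boundary`: the dual handles have dimension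
`n + 1 - 1 ≥ 3`, Hatcher's Prop. 1.26; and the factorisation above).
[cite: HatcherAT2002, Prop. 1.26] [cite: Kosinski1993, VII §7] -/
theorem HasHandleDecomposition.bijective_mapOfEq_inclContinuousMap [T2Space V] [SecondCountableTopology V]
    [CompactSpace V] [ConnectedSpace V] [IsManifold (𝓡∂ (n + 1)) ∞ V] {k : ℕ}
    (hk : HasHandleDecomposition n V (handleCount 1 k)) (hn : 3 ≤ n) (z : b.carrier) :
    Bijective (FundamentalGroup.mapOfEq b.inclContinuousMap (rfl : b.inclContinuousMap z = b.incl z)) := by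
  have hbij := HasHandleDecomposition.bijective_inclHom_boundary hk (handleCount_zero 1 k)
    (fun j hj => handleCount_of_two_le 1 k hj) hn (b.incl_mem_boundary z)
  have hfun : ⇑(FundamentalGroup.mapOfEq b.inclContinuousMap (rfl : b.inclContinuousMap z = b.incl z)) =
      ⇑(VanKampen.inclHom ((𝓡∂ (n + 1)).boundary V) (b.incl z) (b.incl_mem_boundary z)) ∘
        ⇑(Homeomorph.fundamentalGroupCongr b.carrierHomeomorphBoundary
          (Subtype.ext (b.coe_carrierHomeomorphBoundary_apply z))) :=
    funext fun a => b.mapOfEq_inclContinuousMap_eq_inclHom_comp z a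
  rw [hfun]
  exact hbij.comp (MulEquiv.bijective _)

/-- **The boundary manifold of a 1-handlebody is path connected** (dimension `n + 1 ≥ 3`; the
boundary subspace is path connected by `HasHandleDecomposition.isPathConnected_boundary`,
Kosinski VI (11.5), and `b.carrier ≅ ∂V`). [cite: Kosinski1993, VI (11.5)] -/
theorem HasHandleDecomposition.pathConnectedSpace_carrier [T2Space V] [CompactSpace V]
    [ConnectedSpace V] [IsManifold (𝓡∂ (n + 1)) ∞ V] {k : ℕ}
    (hk : HasHandleDecomposition n V (handleCount 1 k)) (hn : 2 ≤ n) :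
    PathConnectedSpace b.carrier := by
  have hpc := hk.isPathConnected_boundary (fun j hj => handleCount_of_two_le 1 k (le_trans hn hj))
    (by omega)
  haveI : PathConnectedSpace ((𝓡∂ (n + 1)).boundary V) :=
    isPathConnected_iff_pathConnectedSpace.1 hpc
  exact b.carrierHomeomorphBoundary.symm.surjective.pathConnectedSpace
    b.carrierHomeomorphBoundary.symm.continuous

end Literature.Topology.FourManifolds
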